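import Summits.NavierStokesRegularity.NavierStokesRegularity.Theorems.LerayQuarterDissipationRecurrentReductionDKernel
import Summits.NavierStokesRegularity.NavierStokesRegularity.Theorems.LerayQuarterDissipationRecurrentReductionDKernelHolder
import Literature.Analysis.FluidPDE.TypeIAncientMild
import HarnessLib

/-!
# Route `LerayQuarterDissipation`, item `RecurrentReductionD` (stmt-NavierStokesRegularity-22507):
# sup-norm ε-regularity for `𝒟`, Stage 2 — induction step A

Helper file (theorems only, `--supports` the item). Stage 1 leaves a Type-I ancient mild field
`v` (constant `C`, slices in `L⁶` with `‖v(τ)‖₆ ≤ k₆(−τ)^{−1/4}`) with a Type-I-SMALL bound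
`‖v‖ ≤ a + η₀(−τ)^{−1/2}` on the parabolic region `Ω₀ = {‖y‖ < R + M√(−τ)}`, `t₁ < τ < 0`.
Stage 2 converts this into an absolute bound by an induction over nested regions
`Ω_n = {‖y‖ < R_n + M√(−τ)}` with invariants `(A_n)` `‖v‖ ≤ a + η_n(−τ)^{−1/2}` on `Ω_n` and
`(B_n)` "the Duhamel influence of the shell `Ω₀ ∖ Ω_n` on `{|v| > 2a}` is `≤ (a/4)(1 − 2^{−n})`
at the points of `Ω_{n+1}`". Step A is proved here (generic radii), step B in the companion file `…Stage2B`: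

* `stage2_stepA` — `(A_n) ∧ (B_n) ⇒ (A_{n+1})`: at `(t,x)` with `‖x‖ < R' + M√(−t)`,
  `R' ≤ R_n`, `R' ≤ 3R/4`, split `|v|² ≤ 4a² + 1_{|v|>2a}|v|²`; the `4a²` part costs
  `8κ₁a²√(−t₁)`, the excess on `Ω_n` costs `16κ₁η_n²(−t)^{−1/2}` (`|v| ≤ 2η_n(−τ)^{−1/2}` there),
  the shell is the hypothesis, the exterior of `Ω₀` is at distance `≥ R/4` and is paid by the
  `L⁶` law (`lintegral_env_mul_enorm_sq_le`), the heat term is a hypothesis;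
* `stage2_stepB` — the ring `Ω_n ∖ Ω_{n+1}` seen from distance `≥ D` costs
  `8η_n C₀c₃ D^{−3/2} k₆ (−t₁)^{1/4}` (`lintegral_env_mul_enorm_le`).

References: G. Koch, N. Nadirashvili, G. Seregin, V. Šverák, arXiv:0709.3599, §3 (3.8), §4
[KochNadirashviliSereginSverak2009].
-/

noncomputable section

-- the summit and its single problem share the name (D-0017 nested layout)
set_option linter.dupNamespace false

namespace Summit.NavierStokesRegularity.NavierStokesRegularity.Theorems.RecurrentReductionD

open MeasureTheory Set Function Filter Topology Metric
open Literature.Analysis Literature.Analysis.FluidPDE Literature.Analysis.UnboundedOperators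
open scoped ENNReal NNReal

/-- On a region where `‖v‖ ≤ a + η(−τ)^{−1/2}`, the excess `1_{‖v‖>2a}‖v‖²` is at most
`4η²(−τ)⁻¹` (if `‖v‖ > 2a` then `η(−τ)^{−1/2} ≥ ‖v‖ − a > ‖v‖/2`). [folklore] -/
theorem excess_le_of_bound {a η τ : ℝ} (hτ : τ < 0)
    {z : EuclideanSpace ℝ (Fin 3)} (hz : ‖z‖ ≤ a + η * (-τ) ^ (-(1 / 2 : ℝ))) :
    indicator {z : EuclideanSpace ℝ (Fin 3) | 2 * a < ‖z‖} (fun z => ‖z‖ₑ ^ 2) z ≤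
      ENNReal.ofReal (4 * η ^ 2 * (-τ)⁻¹) := by
  by_cases h : 2 * a < ‖z‖
  · rw [indicator_of_mem (show z ∈ {z : EuclideanSpace ℝ (Fin 3) | 2 * a < ‖z‖} from h)]
    have hnτ : 0 < -τ := neg_pos.2 hτ
    have hpow : (-τ) ^ (-(1 / 2 : ℝ)) * (-τ) ^ (-(1 / 2 : ℝ)) = (-τ)⁻¹ := by
      rw [← Real.rpow_add hnτ, ← Real.rpow_neg_one]; norm_num
    have h2 : ‖z‖ ≤ 2 * (η * (-τ) ^ (-(1 / 2 : ℝ))) := by linarith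
    rw [← ofReal_norm, ← ENNReal.ofReal_pow (norm_nonneg _)]
    refine ENNReal.ofReal_le_ofReal ?_
    calc ‖z‖ ^ 2 ≤ (2 * (η * (-τ) ^ (-(1 / 2 : ℝ)))) ^ 2 := pow_le_pow_left₀ (norm_nonneg _) h2 2
      _ = 4 * η ^ 2 * (-τ)⁻¹ := by rw [← hpow]; ring
  · rw [indicator_of_notMem (show z ∉ {z : EuclideanSpace ℝ (Fin 3) | 2 * a < ‖z‖} from h)]
    exact bot_le

/-- **Step A of Stage 2** (module docstring): the bound at a point of the next region from
`(A_n)` (on the region of radius `Rn`), the shell hypothesis `(B_n)` at this point, the heat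
hypothesis, the `L⁶` law for the exterior of `Ω₀` (radius `R`, at distance `≥ R/4` since
`‖x‖ < R' + M√(−t)` with `R' ≤ 3R/4`), and the numerical constraints.
[cite: KochNadirashviliSereginSverak2009, §4 p. 8 (arXiv:0709.3599)] -/
theorem stage2_stepA {C₀ : ℝ} (hC₀ : 0 < C₀)
    (hK : ∀ ⦃σ : ℝ⦄, 0 < σ → ∀ z a b : EuclideanSpace ℝ (Fin 3),
      ‖oseenKernel σ z a b‖ ≤ C₀ * (σ + ‖z‖ ^ 2) ^ (-(2 : ℝ)) * ‖a‖ * ‖b‖)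
    {C : ℝ} {v : ℝ → EuclideanSpace ℝ (Fin 3) → EuclideanSpace ℝ (Fin 3)}
    (hv : IsTypeIAncientMild C v) {k₆ : ℝ} (hk₆ : 0 ≤ k₆)
    (hL6 : ∀ τ : ℝ, τ < 0 → eLpNorm (v τ) 6 volume ≤ ENNReal.ofReal (k₆ * (-τ) ^ (-(1 / 4 : ℝ))))
    {t₁ t R R' Rn M a ηn η' S : ℝ} (ht₁ : t₁ < t) (ht : t < 0) (hR : 0 < R) (hM : 0 < M) (ha : 0 < a)
    (hS : 0 ≤ S) (hR'R : R' ≤ 3 * R / 4)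
    (hAn : ∀ τ ∈ Ioo t₁ 0, ∀ y : EuclideanSpace ℝ (Fin 3),
      ‖y‖ < Rn + M * Real.sqrt (-τ) → ‖v τ y‖ ≤ a + ηn * (-τ) ^ (-(1 / 2 : ℝ)))
    {x : EuclideanSpace ℝ (Fin 3)} (hx : ‖x‖ < R' + M * Real.sqrt (-t))
    (hBn : ∫⁻ τ in Ioo t₁ t, ∫⁻ y in ball (0 : EuclideanSpace ℝ (Fin 3)) (R + M * Real.sqrt (-τ)) \
        ball 0 (Rn + M * Real.sqrt (-τ)),
        ENNReal.ofReal (C₀ * ((t - τ) + ‖x - y‖ ^ 2) ^ (-(2 : ℝ))) *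
          indicator {z : EuclideanSpace ℝ (Fin 3) | 2 * a < ‖z‖} (fun z => ‖z‖ₑ ^ 2) (v τ y) ≤
      ENNReal.ofReal S)
    (hheat : ‖heatExtension (v t₁) (t - t₁) x‖ ≤ a / 4)
    (c_a : 32 * (C₀ * ∫ w : EuclideanSpace ℝ (Fin 3), (1 + ‖w‖ ^ 2) ^ (-(2 : ℝ))) * a *
      Real.sqrt (-t₁) ≤ 1)
    (c_η : 16 * (C₀ * ∫ w : EuclideanSpace ℝ (Fin 3), (1 + ‖w‖ ^ 2) ^ (-(2 : ℝ))) * ηn ^ 2 ≤ η')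
    (c_ext : 32 * (C₀ * (3 * (volume : Measure (EuclideanSpace ℝ (Fin 3))).real (ball 0 1) * (1 / 3)) ^
        (2 / 3 : ℝ)) * R ^ (-(2 : ℝ)) * k₆ ^ 2 * Real.sqrt (-t₁) ≤ a / 4) :
    ‖v t x‖ ≤ a / 4 + a / 4 + S + a / 4 + η' * (-t) ^ (-(1 / 2 : ℝ)) := by
  -- ## constants
  set I₂ : ℝ := ∫ w : EuclideanSpace ℝ (Fin 3), (1 + ‖w‖ ^ 2) ^ (-(2 : ℝ)) with hI₂
  set κ₁ : ℝ := C₀ * I₂ with hκ₁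
  set c₄ : ℝ := (3 * (volume : Measure (EuclideanSpace ℝ (Fin 3))).real (ball 0 1) * (1 / 3)) ^
    (2 / 3 : ℝ) with hc₄
  have hI₂pos : 0 < I₂ := integral_one_add_norm_sq_rpow_neg_pos (E := EuclideanSpace ℝ (Fin 3))
    (by rw [finrank_euclideanSpace_fin]; norm_num)
  have hκ₁0 : 0 ≤ κ₁ := by positivity
  have hc₄0 : 0 ≤ c₄ := by positivity
  have hC : 0 ≤ C := hv.nonneg
  have hnt : 0 < -t := neg_pos.2 ht
  -- ## the mild identity and the Duhamel majorant
  have hmild : v t x = heatExtension (v t₁) (t - t₁) x - oseenDuhamel 1 t₁ v v t x :=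
    hv.mild_eq_heatExtension ht₁ ht x
  have hmaj := enorm_oseenDuhamel_le_lintegral hC₀.le hK t₁ t v x
  set exc : ℝ → EuclideanSpace ℝ (Fin 3) → ℝ≥0∞ := fun τ y =>
    indicator {z : EuclideanSpace ℝ (Fin 3) | 2 * a < ‖z‖} (fun z => ‖z‖ₑ ^ 2) (v τ y) with hexc
  set env : ℝ → EuclideanSpace ℝ (Fin 3) → ℝ≥0∞ := fun τ y =>
    ENNReal.ofReal (C₀ * ((t - τ) + ‖x - y‖ ^ 2) ^ (-(2 : ℝ))) with henvdef
  -- kernel integral over all space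
  have henv : ∀ τ, τ < t → ∫⁻ y, env τ y = ENNReal.ofReal (κ₁ * (t - τ) ^ (-(1 / 2 : ℝ))) := by
    intro τ hτ
    have hσ : 0 < t - τ := sub_pos.2 hτ
    have e : ∀ y, env τ y = ENNReal.ofReal C₀ * ENNReal.ofReal (((t - τ) + ‖x - y‖ ^ 2) ^ (-(2 : ℝ))) :=
      fun y => ENNReal.ofReal_mul hC₀.le
    simp_rw [e]
    rw [lintegral_const_mul' _ _ ENNReal.ofReal_ne_top, lintegral_env_eq hσ x, ← ENNReal.ofReal_mul hC₀.le]
    congr 1; rw [hκ₁]; ring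
  -- pointwise split of `‖v‖²`
  have hsplit : ∀ τ y, ‖v τ y‖ₑ ^ 2 ≤ ENNReal.ofReal (4 * a ^ 2) + exc τ y := by
    intro τ y
    by_cases h : 2 * a < ‖v τ y‖
    · simp only [hexc]
      rw [indicator_of_mem (show v τ y ∈ {z : EuclideanSpace ℝ (Fin 3) | 2 * a < ‖z‖} from h)]
      exact le_add_self
    · have h' : ‖v τ y‖ ≤ 2 * a := not_lt.1 h
      refine le_add_right ?_
      rw [← ofReal_norm, ← ENNReal.ofReal_pow (norm_nonneg _)]
      refine ENNReal.ofReal_le_ofReal ?_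
      nlinarith [norm_nonneg (v τ y)]
  -- ## the majorants in time
  set F : ℝ → ℝ≥0∞ := fun τ =>
    ENNReal.ofReal ((4 * a ^ 2 * κ₁) * (t - τ) ^ (-(1 / 2 : ℝ))) +
      ENNReal.ofReal ((4 * ηn ^ 2 * κ₁) * ((t - τ) ^ (-(1 / 2 : ℝ)) * (-τ)⁻¹)) +
      ENNReal.ofReal ((C₀ * c₄ * (R / 4) ^ (-(2 : ℝ)) * k₆ ^ 2) * (-τ) ^ (-(1 / 2 : ℝ))) with hF
  set SH : ℝ → ℝ≥0∞ := fun τ =>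
    ∫⁻ y in ball (0 : EuclideanSpace ℝ (Fin 3)) (R + M * Real.sqrt (-τ)) \
      ball 0 (Rn + M * Real.sqrt (-τ)), env τ y * exc τ y with hSH
  -- ## the pointwise bound of the space integral
  have hslice : ∀ τ ∈ Ioo t₁ t, ∫⁻ y, env τ y * ‖v τ y‖ₑ ^ 2 ≤ F τ + SH τ := by
    intro τ hτ
    have hτt : τ < t := hτ.2
    have hτ0 : τ < 0 := hτt.trans ht
    have hnτ : 0 < -τ := neg_pos.2 hτ0
    have hσ : 0 < t - τ := sub_pos.2 hτt
    set Sn : Set (EuclideanSpace ℝ (Fin 3)) := ball 0 (Rn + M * Real.sqrt (-τ)) with hSn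
    set S0 : Set (EuclideanSpace ℝ (Fin 3)) := ball 0 (R + M * Real.sqrt (-τ)) with hS0
    -- first split: `4a²` part and the excess
    have h1 : ∫⁻ y, env τ y * ‖v τ y‖ₑ ^ 2 ≤
        (∫⁻ y, env τ y * ENNReal.ofReal (4 * a ^ 2)) + ∫⁻ y, env τ y * exc τ y := by
      calc ∫⁻ y, env τ y * ‖v τ y‖ₑ ^ 2 ≤ ∫⁻ y, (env τ y * ENNReal.ofReal (4 * a ^ 2) + env τ y * exc τ y) :=
            lintegral_mono fun y => by rw [← mul_add]; exact mul_le_mul' le_rfl (hsplit τ y)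
        _ = _ := by
            refine lintegral_add_left ?_ _
            simp only [henvdef]; fun_prop
    -- the `4a²` part
    have h2 : ∫⁻ y, env τ y * ENNReal.ofReal (4 * a ^ 2) =
        ENNReal.ofReal ((4 * a ^ 2 * κ₁) * (t - τ) ^ (-(1 / 2 : ℝ))) := by
      rw [lintegral_mul_const' _ _ ENNReal.ofReal_ne_top, henv τ hτt, ← ENNReal.ofReal_mul (by positivity)]
      congr 1; ring
    -- the excess: three regions
    have hcover : (univ : Set (EuclideanSpace ℝ (Fin 3))) ⊆ Sn ∪ (S0 \ Sn) ∪ S0ᶜ := by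
      intro y _
      by_cases hy0 : y ∈ S0
      · by_cases hyn : y ∈ Sn
        · exact Or.inl (Or.inl hyn)
        · exact Or.inl (Or.inr ⟨hy0, hyn⟩)
      · exact Or.inr hy0
    have h3 : ∫⁻ y, env τ y * exc τ y ≤
        (∫⁻ y in Sn, env τ y * exc τ y) + (∫⁻ y in S0 \ Sn, env τ y * exc τ y) +
          ∫⁻ y in S0ᶜ, env τ y * exc τ y := by
      calc ∫⁻ y, env τ y * exc τ y = ∫⁻ y in univ, env τ y * exc τ y := by rw [Measure.restrict_univ]
        _ ≤ ∫⁻ y in Sn ∪ (S0 \ Sn) ∪ S0ᶜ, env τ y * exc τ y := lintegral_mono_set hcover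
        _ ≤ _ := (lintegral_union_le _ _ _).trans (add_le_add (lintegral_union_le _ _ _) le_rfl)
    -- inner region: `exc ≤ 4ηn²/(−τ)`
    have h4 : ∫⁻ y in Sn, env τ y * exc τ y ≤
        ENNReal.ofReal ((4 * ηn ^ 2 * κ₁) * ((t - τ) ^ (-(1 / 2 : ℝ)) * (-τ)⁻¹)) := by
      have hb : ∀ y ∈ Sn, exc τ y ≤ ENNReal.ofReal (4 * ηn ^ 2 * (-τ)⁻¹) := by
        intro y hy
        have hy' : ‖y‖ < Rn + M * Real.sqrt (-τ) := by rwa [hSn, mem_ball_zero_iff] at hy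
        exact excess_le_of_bound hτ0 (hAn τ ⟨hτ.1, hτ0⟩ y hy')
      calc ∫⁻ y in Sn, env τ y * exc τ y
          ≤ ∫⁻ y in Sn, env τ y * ENNReal.ofReal (4 * ηn ^ 2 * (-τ)⁻¹) :=
            setLIntegral_mono' measurableSet_ball fun y hy => mul_le_mul' le_rfl (hb y hy)
        _ ≤ ∫⁻ y, env τ y * ENNReal.ofReal (4 * ηn ^ 2 * (-τ)⁻¹) :=
            lintegral_mono' Measure.restrict_le_self le_rfl
        _ = ENNReal.ofReal (κ₁ * (t - τ) ^ (-(1 / 2 : ℝ))) * ENNReal.ofReal (4 * ηn ^ 2 * (-τ)⁻¹) := by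
            rw [lintegral_mul_const' _ _ ENNReal.ofReal_ne_top, henv τ hτt]
        _ = _ := by
            rw [← ENNReal.ofReal_mul (by positivity)]
            exact congrArg ENNReal.ofReal (by ring)
    -- exterior: `L⁶` law at distance `R/4`
    have h5 : ∫⁻ y in S0ᶜ, env τ y * exc τ y ≤
        ENNReal.ofReal ((C₀ * c₄ * (R / 4) ^ (-(2 : ℝ)) * k₆ ^ 2) * (-τ) ^ (-(1 / 2 : ℝ))) := by
      have hsub : S0ᶜ ⊆ (ball x (R / 4))ᶜ := by
        intro y hy
        rw [hS0, mem_compl_iff, mem_ball_zero_iff, not_lt] at hy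
        rw [mem_compl_iff, mem_ball, not_lt, dist_eq_norm]
        have hst : Real.sqrt (-t) ≤ Real.sqrt (-τ) := Real.sqrt_le_sqrt (by linarith)
        have h1 := norm_sub_norm_le y x
        nlinarith [norm_sub_norm_le y x, hM.le]
      have hexc_le : ∀ y, exc τ y ≤ ‖v τ y‖ₑ ^ 2 := fun y =>
        indicator_le_self _ _ _
      have hL := lintegral_env_mul_enorm_sq_le hσ (by positivity : (0 : ℝ) < R / 4) x
        (hv.aestronglyMeasurable_slice hτ0)
      have hL6' := hL6 τ hτ0
      calc ∫⁻ y in S0ᶜ, env τ y * exc τ y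
          ≤ ∫⁻ y in (ball x (R / 4))ᶜ, env τ y * exc τ y := lintegral_mono_set hsub
        _ ≤ ∫⁻ y in (ball x (R / 4))ᶜ, env τ y * ‖v τ y‖ₑ ^ 2 :=
            lintegral_mono fun y => mul_le_mul' le_rfl (hexc_le y)
        _ = ENNReal.ofReal C₀ * ∫⁻ y in (ball x (R / 4))ᶜ,
              ENNReal.ofReal (((t - τ) + ‖x - y‖ ^ 2) ^ (-(2 : ℝ))) * ‖v τ y‖ₑ ^ 2 := by
            rw [← lintegral_const_mul' _ _ ENNReal.ofReal_ne_top]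
            refine lintegral_congr fun y => ?_
            simp only [henvdef]
            rw [ENNReal.ofReal_mul hC₀.le, mul_assoc]
        _ ≤ ENNReal.ofReal C₀ * (ENNReal.ofReal (c₄ * (R / 4) ^ (-(2 : ℝ))) * eLpNorm (v τ) 6 volume ^ 2) := by
            gcongr
        _ ≤ ENNReal.ofReal C₀ * (ENNReal.ofReal (c₄ * (R / 4) ^ (-(2 : ℝ))) *
              ENNReal.ofReal (k₆ * (-τ) ^ (-(1 / 4 : ℝ))) ^ 2) := by
            gcongr
        _ = _ := by
            rw [← ENNReal.ofReal_pow (by positivity), ← ENNReal.ofReal_mul (by positivity),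
              ← ENNReal.ofReal_mul hC₀.le]
            congr 1
            have e : ((-τ) ^ (-(1 / 4 : ℝ))) ^ 2 = (-τ) ^ (-(1 / 2 : ℝ)) := by
              rw [← Real.rpow_natCast, ← Real.rpow_mul hnτ.le]; norm_num
            rw [mul_pow, e]; ring
    calc ∫⁻ y, env τ y * ‖v τ y‖ₑ ^ 2
        ≤ (∫⁻ y, env τ y * ENNReal.ofReal (4 * a ^ 2)) + ∫⁻ y, env τ y * exc τ y := h1
      _ ≤ ENNReal.ofReal ((4 * a ^ 2 * κ₁) * (t - τ) ^ (-(1 / 2 : ℝ))) +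
            ((∫⁻ y in Sn, env τ y * exc τ y) + (∫⁻ y in S0 \ Sn, env τ y * exc τ y) +
              ∫⁻ y in S0ᶜ, env τ y * exc τ y) := by rw [h2]; exact add_le_add le_rfl h3
      _ ≤ ENNReal.ofReal ((4 * a ^ 2 * κ₁) * (t - τ) ^ (-(1 / 2 : ℝ))) +
            (ENNReal.ofReal ((4 * ηn ^ 2 * κ₁) * ((t - τ) ^ (-(1 / 2 : ℝ)) * (-τ)⁻¹)) + SH τ +
              ENNReal.ofReal ((C₀ * c₄ * (R / 4) ^ (-(2 : ℝ)) * k₆ ^ 2) * (-τ) ^ (-(1 / 2 : ℝ)))) :=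
          add_le_add le_rfl (add_le_add (add_le_add h4 le_rfl) h5)
      _ = F τ + SH τ := by simp only [hF]; ring
  -- ## time integration
  have hFmeas : Measurable F := by simp only [hF]; fun_prop
  have hIF : ∫⁻ τ in Ioo t₁ t, F τ ≤
      ENNReal.ofReal (8 * κ₁ * a ^ 2 * Real.sqrt (-t₁) + 16 * κ₁ * ηn ^ 2 * (-t) ^ (-(1 / 2 : ℝ)) +
        32 * (C₀ * c₄) * R ^ (-(2 : ℝ)) * k₆ ^ 2 * Real.sqrt (-t₁)) := by
    have hm1 : Measurable fun τ : ℝ => ENNReal.ofReal ((4 * a ^ 2 * κ₁) * (t - τ) ^ (-(1 / 2 : ℝ))) := by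
      fun_prop
    have hm2 : Measurable fun τ : ℝ =>
        ENNReal.ofReal ((4 * ηn ^ 2 * κ₁) * ((t - τ) ^ (-(1 / 2 : ℝ)) * (-τ)⁻¹)) := by fun_prop
    have hm12 : Measurable fun τ : ℝ => ENNReal.ofReal ((4 * a ^ 2 * κ₁) * (t - τ) ^ (-(1 / 2 : ℝ))) +
        ENNReal.ofReal ((4 * ηn ^ 2 * κ₁) * ((t - τ) ^ (-(1 / 2 : ℝ)) * (-τ)⁻¹)) := hm1.add hm2
    have e1 : ∫⁻ τ in Ioo t₁ t, ENNReal.ofReal ((4 * a ^ 2 * κ₁) * (t - τ) ^ (-(1 / 2 : ℝ))) =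
        ENNReal.ofReal (4 * a ^ 2 * κ₁) * ∫⁻ τ in Ioo t₁ t, ENNReal.ofReal ((t - τ) ^ (-(1 / 2 : ℝ))) := by
      rw [← lintegral_const_mul' _ _ ENNReal.ofReal_ne_top]
      exact lintegral_congr fun τ => ENNReal.ofReal_mul (by positivity)
    have e2 : ∫⁻ τ in Ioo t₁ t, ENNReal.ofReal ((4 * ηn ^ 2 * κ₁) * ((t - τ) ^ (-(1 / 2 : ℝ)) * (-τ)⁻¹)) =
        ENNReal.ofReal (4 * ηn ^ 2 * κ₁) *
          ∫⁻ τ in Ioo t₁ t, ENNReal.ofReal ((t - τ) ^ (-(1 / 2 : ℝ)) * (-τ)⁻¹) := by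
      rw [← lintegral_const_mul' _ _ ENNReal.ofReal_ne_top]
      exact lintegral_congr fun τ => ENNReal.ofReal_mul (by positivity)
    have e3 : ∫⁻ τ in Ioo t₁ t, ENNReal.ofReal ((C₀ * c₄ * (R / 4) ^ (-(2 : ℝ)) * k₆ ^ 2) * (-τ) ^ (-(1 / 2 : ℝ))) =
        ENNReal.ofReal (C₀ * c₄ * (R / 4) ^ (-(2 : ℝ)) * k₆ ^ 2) *
          ∫⁻ τ in Ioo t₁ t, ENNReal.ofReal ((-τ) ^ (-(1 / 2 : ℝ))) := by
      rw [← lintegral_const_mul' _ _ ENNReal.ofReal_ne_top]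
      exact lintegral_congr fun τ => ENNReal.ofReal_mul (by positivity)
    have i1 : ∫⁻ τ in Ioo t₁ t, ENNReal.ofReal ((t - τ) ^ (-(1 / 2 : ℝ))) ≤
        ENNReal.ofReal (2 * Real.sqrt (-t₁)) := by
      rw [setLIntegral_Ioo_sub_rpow_neg_half_of_lt ht₁]
      exact ENNReal.ofReal_le_ofReal (by gcongr; linarith)
    have i2 := lintegral_Ioo_sub_rpow_half_mul_neg_inv_le t₁ ht
    have i3 : ∫⁻ τ in Ioo t₁ t, ENNReal.ofReal ((-τ) ^ (-(1 / 2 : ℝ))) ≤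
        ENNReal.ofReal (2 * Real.sqrt (-t₁)) := by
      refine (lintegral_Ioo_neg_rpow_le (by norm_num : (1 / 2 : ℝ) < 1) ht₁ ht.le).trans ?_
      refine ENNReal.ofReal_le_ofReal (le_of_eq ?_)
      rw [show (1 : ℝ) - 1 / 2 = 1 / 2 by norm_num, Real.sqrt_eq_rpow]; ring
    have hR4 : (R / 4) ^ (-(2 : ℝ)) = 16 * R ^ (-(2 : ℝ)) := by
      rw [div_eq_mul_inv, Real.mul_rpow hR.le (by norm_num), Real.inv_rpow (by norm_num), mul_comm]
      congr 1
      rw [← Real.rpow_neg_one, ← Real.rpow_mul (by norm_num)]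
      rw [show (-(2 : ℝ)) * -1 = ((2 : ℕ) : ℝ) by norm_num, Real.rpow_natCast]
      norm_num
    calc ∫⁻ τ in Ioo t₁ t, F τ
        = (∫⁻ τ in Ioo t₁ t, (ENNReal.ofReal ((4 * a ^ 2 * κ₁) * (t - τ) ^ (-(1 / 2 : ℝ))) +
            ENNReal.ofReal ((4 * ηn ^ 2 * κ₁) * ((t - τ) ^ (-(1 / 2 : ℝ)) * (-τ)⁻¹)))) +
            ∫⁻ τ in Ioo t₁ t,
              ENNReal.ofReal ((C₀ * c₄ * (R / 4) ^ (-(2 : ℝ)) * k₆ ^ 2) * (-τ) ^ (-(1 / 2 : ℝ))) := by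
          simp only [hF]; exact lintegral_add_left hm12 _
      _ = ENNReal.ofReal (4 * a ^ 2 * κ₁) * (∫⁻ τ in Ioo t₁ t, ENNReal.ofReal ((t - τ) ^ (-(1 / 2 : ℝ)))) +
            ENNReal.ofReal (4 * ηn ^ 2 * κ₁) *
              (∫⁻ τ in Ioo t₁ t, ENNReal.ofReal ((t - τ) ^ (-(1 / 2 : ℝ)) * (-τ)⁻¹)) +
            ENNReal.ofReal (C₀ * c₄ * (R / 4) ^ (-(2 : ℝ)) * k₆ ^ 2) *
              ∫⁻ τ in Ioo t₁ t, ENNReal.ofReal ((-τ) ^ (-(1 / 2 : ℝ))) := by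
          rw [lintegral_add_left hm1, e1, e2, e3]
      _ ≤ ENNReal.ofReal (4 * a ^ 2 * κ₁) * ENNReal.ofReal (2 * Real.sqrt (-t₁)) +
            ENNReal.ofReal (4 * ηn ^ 2 * κ₁) * ENNReal.ofReal (4 * (-t) ^ (-(1 / 2 : ℝ))) +
            ENNReal.ofReal (C₀ * c₄ * (R / 4) ^ (-(2 : ℝ)) * k₆ ^ 2) * ENNReal.ofReal (2 * Real.sqrt (-t₁)) := by
          gcongr
      _ = _ := by
          rw [← ENNReal.ofReal_mul (by positivity), ← ENNReal.ofReal_mul (by positivity),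
            ← ENNReal.ofReal_mul (by positivity), ← ENNReal.ofReal_add (by positivity) (by positivity),
            ← ENNReal.ofReal_add (by positivity) (by positivity)]
          refine congrArg ENNReal.ofReal ?_
          rw [hR4]; ring
  -- ## assemble
  have hX : 0 ≤ 8 * κ₁ * a ^ 2 * Real.sqrt (-t₁) + 16 * κ₁ * ηn ^ 2 * (-t) ^ (-(1 / 2 : ℝ)) +
      32 * (C₀ * c₄) * R ^ (-(2 : ℝ)) * k₆ ^ 2 * Real.sqrt (-t₁) := by positivity
  have hB : ‖oseenDuhamel 1 t₁ v v t x‖ ≤ (8 * κ₁ * a ^ 2 * Real.sqrt (-t₁) +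
      16 * κ₁ * ηn ^ 2 * (-t) ^ (-(1 / 2 : ℝ)) + 32 * (C₀ * c₄) * R ^ (-(2 : ℝ)) * k₆ ^ 2 * Real.sqrt (-t₁)) + S := by
    have h1 : ∫⁻ τ in Ioo t₁ t, (F τ + SH τ) ≤
        ENNReal.ofReal (8 * κ₁ * a ^ 2 * Real.sqrt (-t₁) + 16 * κ₁ * ηn ^ 2 * (-t) ^ (-(1 / 2 : ℝ)) +
          32 * (C₀ * c₄) * R ^ (-(2 : ℝ)) * k₆ ^ 2 * Real.sqrt (-t₁)) + ENNReal.ofReal S := by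
      rw [lintegral_add_left hFmeas]; exact add_le_add hIF hBn
    have h := hmaj.trans ((setLIntegral_mono' measurableSet_Ioo hslice).trans h1)
    rw [← ENNReal.ofReal_add hX hS, ← ofReal_norm, ENNReal.ofReal_le_ofReal_iff (add_nonneg hX hS)] at h
    exact h
  -- numeric constraints
  have hpow : 0 ≤ (-t) ^ (-(1 / 2 : ℝ)) := Real.rpow_nonneg hnt.le _
  have n1 : 8 * κ₁ * a ^ 2 * Real.sqrt (-t₁) ≤ a / 4 := by
    calc 8 * κ₁ * a ^ 2 * Real.sqrt (-t₁) = a / 4 * (32 * κ₁ * a * Real.sqrt (-t₁)) := by ring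
      _ ≤ a / 4 * 1 := mul_le_mul_of_nonneg_left c_a (by positivity)
      _ = a / 4 := mul_one _
  have n2 : 16 * κ₁ * ηn ^ 2 * (-t) ^ (-(1 / 2 : ℝ)) ≤ η' * (-t) ^ (-(1 / 2 : ℝ)) :=
    mul_le_mul_of_nonneg_right c_η hpow
  have n3 : 32 * (C₀ * c₄) * R ^ (-(2 : ℝ)) * k₆ ^ 2 * Real.sqrt (-t₁) ≤ a / 4 := c_ext
  rw [hmild]
  refine (norm_sub_le _ _).trans ?_
  linarith

end Summit.NavierStokesRegularity.NavierStokesRegularity.Theorems.RecurrentReductionD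

end
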